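import Literature.Analysis.FunctionSpaces.BesselKPolya
import HarnessLib

/-!
# `K_ν`: the Mellin-type integral `∫₀^∞ u^{ν−1} e^{−x(u/c + c/u)/2} du = 2 c^ν K_ν(x)` and uniform exponential bounds

Second sibling proof file of `Literature/Analysis/FunctionSpaces/BesselK.lean` (no new
definitions). Two groups of results about the Macdonald function
`besselK ν z = ∫₀^∞ e^{−z cosh t} cosh(νt) dt` of `BesselK.lean`, both needed for the
Chowla–Selberg formula (Bateman–Grosswald 1964, Theorem 1;
`Literature/Barriers/RiemannHypothesis/EpsteinZetaBatemanGrosswald.lean`):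

* **the first equality of Bateman–Grosswald's definition (2)**,
  "`K_ν(z) = ½ ∫₀^∞ e^{−z(u + u⁻¹)/2} u^{ν−1} du`" (`two_mul_besselK_eq_integral_Ioi`, real
  `z = x > 0`, every complex `ν`), in the scaled form
  `∫₀^∞ u^{ν−1} e^{−x(u/c + c/u)/2} du = 2 c^ν K_ν(x)` (`c > 0`;
  `integral_cpow_mul_exp_neg_half_mul`) and in the classical form
  `∫₀^∞ t^{ν−1} e^{−At − B/t} dt = 2 (B/A)^{ν/2} K_ν(2√(AB))` (`A, B > 0`;
  `integral_cpow_mul_exp_neg_mul_sub_div`), with the integrability of the integrand and the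
  real-valued versions — by the change of variables `u = c e^t` in Mathlib's one-variable
  change-of-variables formula and the tree's `2K_ν(x) = ∫_ℝ e^{−x cosh t} e^{νt} dt`
  (`two_mul_besselK_eq_integral`);
* **uniform exponential decay** `‖K_ν(x)‖ ≤ ½ e^{a−x} M₀(a, R)` for `0 < a ≤ x`, `‖ν‖ ≤ R`
  (`norm_besselK_le_of_norm_le`), where `M₀(a, R) = ∫_ℝ e^{−a cosh t} e^{R|t|} dt` is Pólya's moment
  `Literature.Analysis.Complex.Polya1926.polyaM 0 a R` — from `norm_polyaG_le` of
  `PolyaBesselKernel.lean` through the bridge `2K_ν(x) = 𝔊₀(x, −iν)`.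

## References

* [BatemanGrosswald1964] P. T. Bateman, E. Grosswald, *On Epstein's zeta function*, Acta Arith. 9
  (1964) 365–373, §1 (2).
* [Titchmarsh1986] E. C. Titchmarsh, *The Theory of the Riemann Zeta-Function*, 2nd ed., §10.23
  (the decay of `K_z(a)` in `a`), as used in `PolyaBesselKernel.lean`.
-/

noncomputable section

open MeasureTheory Set Real Complex
open Literature.Analysis.Complex.Polya1926

namespace Literature.Analysis.FunctionSpaces

/-! ## Uniform exponential bounds -/

/-- Pólya's moment `M_n(a, w)` depends on `w` only through `‖w‖`; in particular
`M_n(a, −iν) = M_n(a, ν)`. [folklore] -/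
theorem polyaM_neg_I_mul (n : ℕ) (a : ℝ) (ν : ℂ) : polyaM n a (-I * ν) = polyaM n a ν := by
  simp [polyaM]

/-- `M_n(a, w)` is monotone in `‖w‖` (`a > 0`). [folklore] -/
theorem polyaM_mono {a : ℝ} (ha : 0 < a) (n : ℕ) {w w' : ℂ} (h : ‖w‖ ≤ ‖w'‖) :
    polyaM n a w ≤ polyaM n a w' := by
  unfold polyaM
  refine integral_mono (integrable_polyaKernel_mul_exp ha n ‖w‖)
    (integrable_polyaKernel_mul_exp ha n ‖w'‖) fun t => ?_
  have hk := polyaKernel_nonneg n a t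
  have : Real.exp (‖w‖ * |t|) ≤ Real.exp (‖w'‖ * |t|) :=
    Real.exp_le_exp.2 (mul_le_mul_of_nonneg_right h (abs_nonneg t))
  exact mul_le_mul_of_nonneg_left this hk

/-- **Exponential decay of `K_ν(x)` in `x`, uniformly on `‖ν‖ ≤ R`:**
`‖K_ν(x)‖ ≤ ½ e^{a−x} M₀(a, ν)` for `0 < a ≤ x` (`M₀ = polyaM 0`), from `2K_ν(x) = 𝔊₀(x, −iν)` and
`‖𝔊₀(x, w)‖ ≤ e^{a−x} M₀(a, w)`. [cite: Titchmarsh1986, §10.23] -/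
theorem norm_besselK_le {a x : ℝ} (ha : 0 < a) (hax : a ≤ x) (ν : ℂ) :
    ‖besselK ν x‖ ≤ Real.exp (a - x) / 2 * polyaM 0 a ν := by
  have hx : 0 < x := lt_of_lt_of_le ha hax
  have h := norm_polyaG_le ha hax 0 (-I * ν)
  rw [← two_mul_besselK_eq_polyaG hx, polyaM_neg_I_mul, norm_mul, Complex.norm_two] at h
  linarith

/-- The uniform form: `‖K_ν(x)‖ ≤ ½ e^{a−x} M₀(a, R)` whenever `0 < a ≤ x` and `‖ν‖ ≤ R`.
[cite: Titchmarsh1986, §10.23] -/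
theorem norm_besselK_le_of_norm_le {a x R : ℝ} (ha : 0 < a) (hax : a ≤ x) (hR : 0 ≤ R) {ν : ℂ}
    (hν : ‖ν‖ ≤ R) : ‖besselK ν x‖ ≤ Real.exp (a - x) / 2 * polyaM 0 a R := by
  refine (norm_besselK_le ha hax ν).trans ?_
  have hM : polyaM 0 a ν ≤ polyaM 0 a R :=
    polyaM_mono ha 0 (by rwa [Complex.norm_real, Real.norm_eq_abs, abs_of_nonneg hR])
  exact mul_le_mul_of_nonneg_left hM (by positivity)

/-- The real value `K_μ(x)` (`μ` real, `x ≥ a > 0`) obeys the same bound. [folklore] -/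
theorem besselK_re_le {a x : ℝ} (ha : 0 < a) (hax : a ≤ x) (μ : ℝ) :
    (besselK μ x).re ≤ Real.exp (a - x) / 2 * polyaM 0 a μ :=
  (Complex.re_le_norm _).trans (norm_besselK_le ha hax μ)

/-! ## The substitution `u = c e^t` -/

/-- The integrand of the `u`-integral, transported to the line by `u = c e^t`:
`(c e^t) · (c e^t)^{ν−1} e^{−x(e^t + e^{−t})/2} = c^ν e^{νt} e^{−x cosh t}`. [folklore] -/
theorem mul_cpow_exp_aux {x c : ℝ} (hc : 0 < c) (ν : ℂ) (t : ℝ) :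
    ((c * Real.exp t : ℝ) : ℂ) * ((((c * Real.exp t : ℝ) : ℂ) ^ (ν - 1)) *
        (Real.exp (-(x / 2 * (c * Real.exp t / c + c / (c * Real.exp t)))) : ℂ)) =
      (c : ℂ) ^ ν * (Complex.exp (-(x : ℂ) * (Real.cosh t : ℂ)) * Complex.exp (ν * t)) := by
  have hct : 0 < c * Real.exp t := mul_pos hc (Real.exp_pos t)
  have hne : ((c * Real.exp t : ℝ) : ℂ) ≠ 0 := Complex.ofReal_ne_zero.2 hct.ne'
  -- the power
  have hpow : ((c * Real.exp t : ℝ) : ℂ) * ((c * Real.exp t : ℝ) : ℂ) ^ (ν - 1) =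
      (c : ℂ) ^ ν * Complex.exp (ν * t) := by
    rw [cpow_sub _ _ hne, cpow_one, mul_div_cancel₀ _ hne, Complex.ofReal_mul,
      mul_cpow_ofReal_nonneg hc.le (Real.exp_pos t).le, Complex.ofReal_exp,
      cpow_def_of_ne_zero (Complex.exp_ne_zero _), Complex.log_exp (by simp [Real.pi_pos])
        (by simpa using Real.pi_pos.le)]
    ring_nf
  -- the exponential
  have hexp : (Real.exp (-(x / 2 * (c * Real.exp t / c + c / (c * Real.exp t)))) : ℂ) =
      Complex.exp (-(x : ℂ) * (Real.cosh t : ℂ)) := by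
    have e1 : c * Real.exp t / c + c / (c * Real.exp t) = 2 * Real.cosh t := by
      rw [Real.cosh_eq, Real.exp_neg]
      field_simp
    rw [e1, Complex.ofReal_exp]
    push_cast
    ring_nf
  calc ((c * Real.exp t : ℝ) : ℂ) * ((((c * Real.exp t : ℝ) : ℂ) ^ (ν - 1)) *
        (Real.exp (-(x / 2 * (c * Real.exp t / c + c / (c * Real.exp t)))) : ℂ))
      = (((c * Real.exp t : ℝ) : ℂ) * ((c * Real.exp t : ℝ) : ℂ) ^ (ν - 1)) *
          (Real.exp (-(x / 2 * (c * Real.exp t / c + c / (c * Real.exp t)))) : ℂ) := by ring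
    _ = _ := by rw [hpow, hexp]; ring

/-- Change of variables `u = c e^t` (`c > 0`): `∫_{(0,∞)} G(u) du = ∫_ℝ (c e^t) G(c e^t) dt`, and
`G` is integrable on `(0, ∞)` iff `t ↦ c e^t G(c e^t)` is integrable (Mathlib's one-variable
change-of-variables formula for the injective smooth map `t ↦ c e^t` with image `(0, ∞)`).
[folklore] -/
theorem integral_Ioi_eq_integral_mul_exp {E : Type*} [NormedAddCommGroup E] [NormedSpace ℝ E]
    {c : ℝ} (hc : 0 < c) (G : ℝ → E) :
    (∫ u in Ioi (0 : ℝ), G u = ∫ t : ℝ, (c * Real.exp t) • G (c * Real.exp t)) ∧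
      (IntegrableOn G (Ioi 0) ↔ Integrable fun t : ℝ => (c * Real.exp t) • G (c * Real.exp t)) := by
  have hderiv : ∀ t ∈ (univ : Set ℝ),
      HasDerivWithinAt (fun t => c * Real.exp t) (c * Real.exp t) univ t :=
    fun t _ => ((Real.hasDerivAt_exp t).const_mul c).hasDerivWithinAt
  have hinj : InjOn (fun t => c * Real.exp t) univ :=
    fun s _ t _ h => Real.exp_injective (mul_left_cancel₀ hc.ne' h)
  have himage : (fun t => c * Real.exp t) '' univ = Ioi 0 := by
    ext u
    simp only [Set.image_univ, Set.mem_range, Set.mem_Ioi]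
    constructor
    · rintro ⟨t, rfl⟩; exact mul_pos hc (Real.exp_pos t)
    · intro hu
      exact ⟨Real.log (u / c), by rw [Real.exp_log (div_pos hu hc)]; field_simp⟩
  have habs : ∀ t : ℝ, |c * Real.exp t| = c * Real.exp t := fun t =>
    abs_of_pos (mul_pos hc (Real.exp_pos t))
  constructor
  · have h := integral_image_eq_integral_abs_deriv_smul MeasurableSet.univ hderiv hinj G
    rw [himage, Measure.restrict_univ] at h
    rw [h]
    exact integral_congr_ae (ae_of_all _ fun t => by simp only [habs])
  · have h := integrableOn_image_iff_integrableOn_abs_deriv_smul MeasurableSet.univ hderiv hinj G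
    rw [himage, integrableOn_univ] at h
    rw [h]
    exact integrable_congr (ae_of_all _ fun t => by simp only [habs])

/-! ## The `u`-integrals -/

/-- **`∫₀^∞ u^{ν−1} e^{−x(u/c + c/u)/2} du = 2 c^ν K_ν(x)`** for `x > 0`, `c > 0` and every complex
`ν`, and the integrand is integrable. (Substituting `u = c e^t` turns the integral into
`c^ν ∫_ℝ e^{−x cosh t} e^{νt} dt = 2 c^ν K_ν(x)`.) [cite: BatemanGrosswald1964, §1 (2)] -/
theorem integral_cpow_mul_exp_neg_half_mul {x c : ℝ} (hx : 0 < x) (hc : 0 < c) (ν : ℂ) :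
    (∫ u in Ioi (0 : ℝ), (u : ℂ) ^ (ν - 1) * (Real.exp (-(x / 2 * (u / c + c / u))) : ℂ)) =
        2 * (c : ℂ) ^ ν * besselK ν x ∧
      IntegrableOn (fun u : ℝ => (u : ℂ) ^ (ν - 1) * (Real.exp (-(x / 2 * (u / c + c / u))) : ℂ))
        (Ioi 0) := by
  set G : ℝ → ℂ := fun u => (u : ℂ) ^ (ν - 1) * (Real.exp (-(x / 2 * (u / c + c / u))) : ℂ)
    with hG
  obtain ⟨hint, hiff⟩ := integral_Ioi_eq_integral_mul_exp hc G
  have hpt : ∀ t : ℝ, (c * Real.exp t) • G (c * Real.exp t) =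
      (c : ℂ) ^ ν * (Complex.exp (-(x : ℂ) * (Real.cosh t : ℂ)) * Complex.exp (ν * t)) := by
    intro t
    rw [hG]
    simp only [real_smul]
    exact mul_cpow_exp_aux hc ν t
  have hline : Integrable fun t : ℝ =>
      (c : ℂ) ^ ν * (Complex.exp (-(x : ℂ) * (Real.cosh t : ℂ)) * Complex.exp (ν * t)) := by
    have h := (integrable_polyaKernel_mul_cexp hx 0 (-I * ν)).const_mul ((c : ℂ) ^ ν)
    refine h.congr (Filter.Eventually.of_forall fun t => ?_)
    simp only
    rw [polyaKernel_zero_mul_cexp]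
  refine ⟨?_, ?_⟩
  · rw [hint, integral_congr_ae (ae_of_all _ hpt), integral_const_mul,
      ← two_mul_besselK_eq_integral hx ν]
    ring
  · rw [hiff]
    exact hline.congr (Filter.Eventually.of_forall fun t => (hpt t).symm)

/-- **Bateman–Grosswald's (2), first equality: `2 K_ν(x) = ∫₀^∞ e^{−x(u + u⁻¹)/2} u^{ν−1} du`**
(`x > 0`, `ν ∈ ℂ`). [cite: BatemanGrosswald1964, §1 (2)] -/
theorem two_mul_besselK_eq_integral_Ioi {x : ℝ} (hx : 0 < x) (ν : ℂ) :
    2 * besselK ν x =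
      ∫ u in Ioi (0 : ℝ), (u : ℂ) ^ (ν - 1) * (Real.exp (-(x / 2 * (u + u⁻¹))) : ℂ) := by
  have h := (integral_cpow_mul_exp_neg_half_mul hx one_pos ν).1
  simp only [div_one, one_div, Complex.ofReal_one, one_cpow, mul_one] at h
  exact h.symm

/-- **The classical Laplace-type integral**: for `A, B > 0` and every complex `ν`,
`∫₀^∞ t^{ν−1} e^{−At − B/t} dt = 2 (√(B/A))^ν K_ν(2√(AB))`, with integrable integrand
(take `x = 2√(AB)`, `c = √(B/A)` above). [folklore] -/
theorem integral_cpow_mul_exp_neg_mul_sub_div {A B : ℝ} (hA : 0 < A) (hB : 0 < B) (ν : ℂ) :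
    (∫ t in Ioi (0 : ℝ), (t : ℂ) ^ (ν - 1) * (Real.exp (-(A * t + B / t)) : ℂ)) =
        2 * ((Real.sqrt (B / A) : ℝ) : ℂ) ^ ν * besselK ν ((2 * Real.sqrt (A * B) : ℝ) : ℂ) ∧
      IntegrableOn (fun t : ℝ => (t : ℂ) ^ (ν - 1) * (Real.exp (-(A * t + B / t)) : ℂ)) (Ioi 0) := by
  set c := Real.sqrt (B / A) with hc
  set x := 2 * Real.sqrt (A * B) with hx
  have hcpos : 0 < c := Real.sqrt_pos.2 (div_pos hB hA)
  have hxpos : 0 < x := mul_pos two_pos (Real.sqrt_pos.2 (mul_pos hA hB))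
  have hsA : Real.sqrt (A * B) / c = A := by
    rw [hc, ← Real.sqrt_div (mul_pos hA hB).le (B / A),
      show A * B / (B / A) = A ^ 2 by field_simp, Real.sqrt_sq hA.le]
  have hsB : Real.sqrt (A * B) * c = B := by
    rw [hc, ← Real.sqrt_mul (mul_pos hA hB).le (B / A),
      show A * B * (B / A) = B ^ 2 by field_simp, Real.sqrt_sq hB.le]
  have hreal : ∀ t : ℝ, A * t + B / t = x / 2 * (t / c + c / t) := by
    intro t
    have e : x / 2 * (t / c + c / t) = Real.sqrt (A * B) / c * t + Real.sqrt (A * B) * c / t := by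
      rw [hx]; field_simp
    simp only [e, hsA, hsB]
  have hfun : ∀ t ∈ Ioi (0 : ℝ), (t : ℂ) ^ (ν - 1) * (Real.exp (-(A * t + B / t)) : ℂ) =
      (t : ℂ) ^ (ν - 1) * (Real.exp (-(x / 2 * (t / c + c / t))) : ℂ) := by
    intro t _
    rw [hreal t]
  have h := integral_cpow_mul_exp_neg_half_mul hxpos hcpos ν
  rw [← setIntegral_congr_fun measurableSet_Ioi hfun] at h
  refine ⟨h.1, ?_⟩
  exact h.2.congr_fun (fun t ht => (hfun t ht).symm) measurableSet_Ioi

/-- Real-valued version: for `A, B > 0` and real `μ`,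
`∫₀^∞ t^{μ−1} e^{−At − B/t} dt = 2 (√(B/A))^μ K_μ(2√(AB))` (a positive real number), with
integrable integrand. [folklore] -/
theorem integral_rpow_mul_exp_neg_mul_sub_div {A B : ℝ} (hA : 0 < A) (hB : 0 < B) (μ : ℝ) :
    (∫ t in Ioi (0 : ℝ), t ^ (μ - 1) * Real.exp (-(A * t + B / t))) =
        2 * Real.sqrt (B / A) ^ μ * (besselK μ ((2 * Real.sqrt (A * B) : ℝ) : ℂ)).re ∧
      IntegrableOn (fun t : ℝ => t ^ (μ - 1) * Real.exp (-(A * t + B / t))) (Ioi 0) := by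
  obtain ⟨hval, hint⟩ := integral_cpow_mul_exp_neg_mul_sub_div hA hB (μ : ℂ)
  have hfun : ∀ t ∈ Ioi (0 : ℝ), ((t : ℂ) ^ ((μ : ℂ) - 1) * (Real.exp (-(A * t + B / t)) : ℂ)) =
      ((t ^ (μ - 1) * Real.exp (-(A * t + B / t)) : ℝ) : ℂ) := by
    intro t ht
    have ht : (0 : ℝ) < t := ht
    rw [show (μ : ℂ) - 1 = ((μ - 1 : ℝ) : ℂ) by push_cast; ring, ← Complex.ofReal_cpow ht.le]
    push_cast
    ring
  rw [setIntegral_congr_fun measurableSet_Ioi hfun, integral_complex_ofReal] at hval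
  have hc0 : 0 ≤ Real.sqrt (B / A) := Real.sqrt_nonneg _
  refine ⟨?_, ?_⟩
  · have := congrArg Complex.re hval
    rw [Complex.ofReal_re] at this
    rw [this, ← Complex.ofReal_cpow hc0, besselK_ofReal]
    simp only [Complex.mul_re, Complex.re_ofNat, Complex.im_ofNat, Complex.ofReal_re,
      Complex.ofReal_im, mul_zero, sub_zero]
  · have h2 : Integrable (fun t : ℝ =>
        RCLike.re ((t : ℂ) ^ ((μ : ℂ) - 1) * (Real.exp (-(A * t + B / t)) : ℂ)))
        (volume.restrict (Ioi 0)) := hint.re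
    refine IntegrableOn.congr_fun h2 (fun t ht => ?_) measurableSet_Ioi
    simp only [RCLike.re_to_complex]
    rw [hfun t ht, Complex.ofReal_re]

end Literature.Analysis.FunctionSpaces
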